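import Summits.BirchSwinnertonDyer.BirchSwinnertonDyer.Theorems.ManinLocalTwoThreeEvenKummerRepCongruencePeriodic
import Summits.BirchSwinnertonDyer.BirchSwinnertonDyer.Theorems.ManinLocalTwoThreeEvenKummerShimuraPosition
import Summits.BirchSwinnertonDyer.BirchSwinnertonDyer.Theorems.ManinLocalTwoThreeSigmaHabitatHolds
import HarnessLib

/-!
# 6b-res♮|_A `CuspidalKummerEvenExponentSquareAtCuspZero` is a THEOREM: on locus A (`{∞,0}_f ∈ Λ₀(f)` ⊇ root number `−1`) no rational `2`-torsion point
# has an all-even cuspidal Kummer representative — UNCONDITIONAL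
(route `ManinLocalTwoThree`, crux C2 `ManinOddAtFour` stmt-BirchSwinnertonDyer-22967; cell bsd-f2-manin, prover seat p3 gen 21; `--supports stmt-BirchSwinnertonDyer-22967`)

an g42's `KummerShimuraTwo.false_of_allEven_of_modularSymbol_zero_mem_of_print` / p2 g20's `EvenKummerCongruence.*_of_print` proved these MODULO F★ ∧ F♮ ∧ CES
(E-an-237 `EvenKummerRepCongruencePeriodic` being p2's theorem `evenKummerRepCongruencePeriodic_holds`).  The three printed inputs entered only through
LEAD's `SigmaHabitat.*_of_print`, now unconditional (`CuspLifting.modularSymbol_zero_not_mem_of_ne`, `CuspLifting.rootNumber_eq_one_of_ne`, p768219,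
via Θ p768114).  Hence, unconditional: `false_of_allEven_of_modularSymbol_zero_mem`, `false_of_allEven_of_rootNumber_eq_neg_one`, and an's row
**`cuspidalKummerEvenExponentSquareAtCuspZero_holds : CuspidalKummerEvenExponentSquareAtCuspZero`** (6b-res♮|_A) BY NAME.

HONEST FRAMING: unconditional, fact-free; the core rows 6b-res♮ / 6b-res still wait on E-an-152 ∧ E-an-152b; C2, Manin's conjecture and BSD are NOT proved.
No definitions, no sorry.
[cite: Stevens1989, §2] [cite: Vatsal2005, Rem. 1.8] [cite: AtkinLehner1970, Thm. 3]
-/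

set_option autoImplicit false
-- lint-debt: the directory name repeats the summit name (sibling precedent `ManinLocalTwoThreeEvenKummerShimuraHolds.lean`)
set_option linter.dupNamespace false

noncomputable section

open scoped PeriodPair MatrixGroups ModularForm NumberField
open Complex PowerSeries CongruenceSubgroup
open IsDedekindDomain IsDedekindDomain.HeightOneSpectrum Rat.HeightOneSpectrum
open WeierstrassCurve Literature.NumberTheory.EllipticCurves Literature.NumberTheory.EllipticCurves.ModularForms
open Summit.BirchSwinnertonDyer.Rank1Residual.ManinAdditive.CuspidalKummer
open Summit.BirchSwinnertonDyer.Rank1Residual.ManinAdditive.ShimuraKernel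
open Summit.BirchSwinnertonDyer.Rank1Residual.ManinAdditive.KummerShimuraTwo
open Summit.BirchSwinnertonDyer.BirchSwinnertonDyer.Theorems.ManinLocalTwoThree.SigmaSquareRoot
open Summit.BirchSwinnertonDyer.BirchSwinnertonDyer.Theorems.ManinLocalTwoThree.UDCTwo
open Summit.BirchSwinnertonDyer.BirchSwinnertonDyer.Theorems.ManinLocalTwoThree.EvenKummerCongruence

namespace Summit.BirchSwinnertonDyer.BirchSwinnertonDyer.Theorems.ManinLocalTwoThree.CuspLifting

section LocusA

variable {W : WeierstrassCurve ℚ} [W.IsElliptic] [W.IsGloballyMinimal] {N : ℕ} [NeZero N]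

/-- **On locus A there is NO all-even cuspidal Kummer representative — UNCONDITIONAL** (E-an-237 is p2's theorem; the congruence conclusion forces
`Λ₁ ≠ Λ₀` (`UDCTwo.periodLatticeGamma1_ne_of_congruence`), contradicting `{∞,0}_f ∈ Λ₀(f)` by Θ). [cite: Stevens1989, §2] -/
theorem false_of_allEven_of_modularSymbol_zero_mem
    (D : ModularParametrizationData W N) (a : ℕ → ℤ) (ha : ∀ n, (a n : ℂ) = cuspCoeff D.f n)
    (hopt : ∀ z ∈ D.L.lattice, ∃ w ∈ periodLattice D.f, z = D.c * w)
    (h0 : modularSymbol D.f 0 ∈ periodLattice D.f)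
    {e : ℤ} (he : W.twoTorsionPolynomial.toPoly.IsRoot (e : ℚ)) {z : ℚ⟦X⟧} (hz : IsParamGerm W D.c a z)
    {r : ℕ → ℤ} {g A B : ℤ⟦X⟧} (hrep : IsCuspidalKummerRep N (kummerSeries W D.c ((e : ℚ)) z) r g A B)
    (hev : ∀ δ ∈ N.divisors, Even (r δ)) : False := by
  obtain ⟨p, hp, h2p, h℘⟩ := exists_halfPeriod_of_twoTorsion_root D he
  obtain ⟨m₁, m₂, hm⟩ := PeriodPair.mem_lattice.mp h2p
  have hN : 0 < 8 * N := Nat.mul_pos (by norm_num) (Nat.pos_of_ne_zero (NeZero.ne N))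
  exact modularSymbol_zero_not_mem_of_ne D
    (periodLatticeGamma1_ne_of_congruence D hopt hp hm.symm hN
      (evenKummerRepCongruencePeriodic_holds W D a ha e he z hz r g A B hrep hev p m₁ m₂ hp hm.symm h℘)) h0

/-- **Root number `−1` ⟹ no all-even cuspidal Kummer representative — UNCONDITIONAL** (conductor level). [cite: AtkinLehner1970, Thm. 3] [cite: Stevens1989, §2] -/
theorem false_of_allEven_of_rootNumber_eq_neg_one [NeZero (W.conductorNorm ℤ)]
    (D : ModularParametrizationData W (W.conductorNorm ℤ)) (a : ℕ → ℤ) (ha : ∀ n, (a n : ℂ) = cuspCoeff D.f n)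
    (hopt : ∀ z ∈ D.L.lattice, ∃ w ∈ periodLattice D.f, z = D.c * w) (hw : W.rootNumber = -1)
    {e : ℤ} (he : W.twoTorsionPolynomial.toPoly.IsRoot (e : ℚ)) {z : ℚ⟦X⟧} (hz : IsParamGerm W D.c a z)
    {r : ℕ → ℤ} {g A B : ℤ⟦X⟧} (hrep : IsCuspidalKummerRep (W.conductorNorm ℤ) (kummerSeries W D.c ((e : ℚ)) z) r g A B)
    (hev : ∀ δ ∈ (W.conductorNorm ℤ).divisors, Even (r δ)) : False := by
  obtain ⟨p, hp, h2p, h℘⟩ := exists_halfPeriod_of_twoTorsion_root D he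
  obtain ⟨m₁, m₂, hm⟩ := PeriodPair.mem_lattice.mp h2p
  have hN : 0 < 8 * W.conductorNorm ℤ := Nat.mul_pos (by norm_num) (Nat.pos_of_ne_zero (NeZero.ne _))
  have h1 := rootNumber_eq_one_of_ne D
    (periodLatticeGamma1_ne_of_congruence D hopt hp hm.symm hN
      (evenKummerRepCongruencePeriodic_holds W D a ha e he z hz r g A B hrep hev p m₁ m₂ hp hm.symm h℘))
  rw [hw] at h1
  norm_num at h1

end LocusA

/-- **6b-res♮|_A `CuspidalKummerEvenExponentSquareAtCuspZero` HOLDS — UNCONDITIONAL** (the all-even hypothesis is contradictory on locus A).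
[cite: Stevens1989, §2] -/
theorem cuspidalKummerEvenExponentSquareAtCuspZero_holds : CuspidalKummerEvenExponentSquareAtCuspZero := by
  intro W _ _ N _ D a ha _h4 hopt h0 a₂ a₄ e _ha1 _ha3 _ha2 _ha4 he _hnb z hz r g A B hrep hev
  exact (false_of_allEven_of_modularSymbol_zero_mem D a ha hopt h0 he hz hrep hev).elim

end Summit.BirchSwinnertonDyer.BirchSwinnertonDyer.Theorems.ManinLocalTwoThree.CuspLifting

end
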